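import Summits.NavierStokesRegularity.NavierStokesRegularity.Theorems.AxisymmetricExtremalityAxisymmetricKatoGlobalStubSeregin2020TypeIILemma22AcrossAxisLayer
import Literature.Analysis.FluidPDE.LeiZhang2011Cutoff
import HarnessLib

/-!
# Seregin 2020, Lemma 2.2 (after Nazarov–Uraltseva 2012): the energy inequality ACROSS THE REGULAR AXIS
# — the registered stub `supersolution_energy_ineq_acrossAxis` of stmt-NavierStokesRegularity-15453 (L22-B, first piece)

Seat ns-es-p1 g3 (INPUTS lane A1, work package L22-B, director-ns KEY-NS #96; cut owner ns-inputs-plan g5; kit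
pub/ns-inputs/kits/A1-L22B.md).  The 08-17 wave landed the energy inequality for cut-offs supported OFF the axis
(`supersolution_energy_ineq_offAxis`, its one-integral form `supersolution_energy_ineq_offAxis_prod`), the space–time
integrability of the five slice integrands for cut-offs MEETING the axis (`integrable_sliceIntegrands_acrossAxis`), the removal of
`[0,1]`-valued cut-offs from bulk terms (`tendsto_integral_mul_of_eventually_eq_one`) and the vanishing of the three LAYER terms of
Seregin's axis cut-off `φ_ε` (`tendsto_integral_axisLayer_zero`).  This file assembles them:

* `supersolution_energy_ineq_acrossAxis` — VERBATIM the registered signature (2026-08-17, lead c2): on a slab `]lo,hi[ × O` with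
  `O` open and possibly MEETING the axis, `Φ` and `∇Φ` continuous on the whole slab, `C²`/time-differentiable data and a continuous
  divergence-free `C¹` drift `U` OFF the axis, `∬|U|³ < ∞`, the pointwise supersolution inequality off the axis, `Φ ≥ k` at the axis
  points, `H ∈ C²` non-increasing with `H = 0` on `[k,∞)`, `Θ ∈ C¹_c(O)`, `η ∈ C¹`, `η ≥ 0`:
  `η(t)M(t) − η(t₁)M(t₁) ≤ ∫_{t₁}^t (η(−(G_H + T₁) + T_U + T_b) + η′M) ds`.
  Proof: apply the off-axis inequality on `O ∩ {ϱ ≠ 0}` to `Θ_n = Θ·φ_{1/(n+1)}`; the space–time integrand splits as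
  `φ_n²·F + ℓ_n` (product rules `gradient_cutoffProduct_sq`, `fderiv_cutoffProduct_sq_apply`); `∫φ_n²F → ∫F`, `∫ℓ_n → 0`,
  `M_n(s) → M(s)` at `s = t₁, t`; Fubini back to slice functionals.

WHAT THIS IS NOT: not yet the class `EnergyClass` for the normalised class-𝒱 pair (that needs, on top: absorption `H′² ≤ 2HH″`, the
`lintegral` slab form, and the passage across the parabolic-null axis set `S`), not Lemma 2.2, not NS regularity.
No summit statement is proved here.  [NazarovUraltseva2012 §3 (3.2), (3.9), Remark 9; Seregin2020 §3 pp. 9–10]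
-/

-- the problem directory repeats the summit name (D-0017); core's `dupNamespace` linter fires
set_option linter.dupNamespace false

noncomputable section

open MeasureTheory Set Function Filter Topology TopologicalSpace Metric WithLp intervalIntegral
open scoped NNReal ENNReal InnerProductSpace RealInnerProductSpace

namespace Summit.NavierStokesRegularity.NavierStokesRegularity.Theorems.AxisymmetricKatoGlobal.EulerScaling

open Literature.Analysis.FluidPDE Literature.Analysis.FluidPDE.Seregin2020

/-- A slice product `g · w` with `g` continuous on an open set `O` and `w` continuous, vanishing off a compact `K ⊆ O`, is
continuous on `ℝ³`. [folklore] -/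
theorem continuous_mul_of_continuousOn_of_eq_zero_off {O K : Set (EuclideanSpace ℝ (Fin 3))} (hO : IsOpen O)
    (hK : IsCompact K) (hKO : K ⊆ O) {g w : EuclideanSpace ℝ (Fin 3) → ℝ} (hg : ContinuousOn g O)
    (hw : Continuous w) (hw0 : ∀ x, x ∉ K → w x = 0) : Continuous fun x => g x * w x := by
  rw [continuous_iff_continuousAt]
  intro x
  by_cases hx : x ∈ O
  · exact (hg.continuousAt (hO.mem_nhds hx)).mul hw.continuousAt
  · have hxK : x ∉ K := fun h => hx (hKO h)
    have hev : ∀ᶠ y in 𝓝 x, g y * w y = 0 := by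
      filter_upwards [hK.isClosed.isOpen_compl.mem_nhds hxK] with y hy
      rw [hw0 y hy, mul_zero]
    have h0 : g x * w x = 0 := by rw [hw0 x hxK, mul_zero]
    rw [ContinuousAt, h0]
    exact tendsto_nhds_of_eventually_eq hev

/-- **The energy inequality ACROSS THE REGULAR AXIS** (registered stub `supersolution_energy_ineq_acrossAxis`,
stmt-NavierStokesRegularity-15453; module docstring).  [cite: NazarovUraltseva2012, §3 (3.2), (3.9), Remark 9] -/
theorem supersolution_energy_ineq_acrossAxis : ∀ (O : Set (EuclideanSpace ℝ (Fin 3))), IsOpen O →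
    ∀ (lo hi : ℝ) (Φ : ℝ → EuclideanSpace ℝ (Fin 3) → ℝ) (U : ℝ → EuclideanSpace ℝ (Fin 3) → EuclideanSpace ℝ (Fin 3)),
    ContinuousOn (uncurry Φ) (Ioo lo hi ×ˢ O) →
    ContinuousOn (fun z : ℝ × EuclideanSpace ℝ (Fin 3) => fderiv ℝ (Φ z.1) z.2) (Ioo lo hi ×ˢ O) →
    (∀ z ∈ Ioo lo hi ×ˢ (O ∩ {x | cylRadius x ≠ 0}), ContDiffAt ℝ 2 (Φ z.1) z.2) →
    (∀ z ∈ Ioo lo hi ×ˢ (O ∩ {x | cylRadius x ≠ 0}), DifferentiableAt ℝ (fun r => Φ r z.2) z.1) →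
    ContinuousOn (fun z : ℝ × EuclideanSpace ℝ (Fin 3) => deriv (fun r => Φ r z.2) z.1)
      (Ioo lo hi ×ˢ (O ∩ {x | cylRadius x ≠ 0})) →
    ContinuousOn (uncurry U) (Ioo lo hi ×ˢ (O ∩ {x | cylRadius x ≠ 0})) →
    (∀ z ∈ Ioo lo hi ×ˢ (O ∩ {x | cylRadius x ≠ 0}), ContDiffAt ℝ 1 (U z.1) z.2) →
    (∀ z ∈ Ioo lo hi ×ˢ (O ∩ {x | cylRadius x ≠ 0}), VectorCalculus.divergence (U z.1) z.2 = 0) →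
    (∫⁻ z in Ioo lo hi ×ˢ O, ‖U z.1 z.2‖ₑ ^ (3 : ℕ)) < ⊤ →
    (∀ z ∈ Ioo lo hi ×ˢ (O ∩ {x | cylRadius x ≠ 0}), 0 ≤ deriv (fun r => Φ r z.2) z.1 +
      fderiv ℝ (Φ z.1) z.2 (U z.1 z.2) + 2 / cylRadius z.2 * partialDeriv (eR z.2) (Φ z.1) z.2 -
      (Laplacian.laplacian (Φ z.1)) z.2) →
    ∀ (k : ℝ), (∀ z ∈ Ioo lo hi ×ˢ O, cylRadius z.2 = 0 → k ≤ Φ z.1 z.2) →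
    ∀ (H : ℝ → ℝ), ContDiff ℝ 2 H → (∀ v, deriv H v ≤ 0) → (∀ v, k ≤ v → H v = 0) →
    ∀ (Θ : EuclideanSpace ℝ (Fin 3) → ℝ), ContDiff ℝ 1 Θ → HasCompactSupport Θ → tsupport Θ ⊆ O →
    ∀ (η : ℝ → ℝ), ContDiff ℝ 1 η → (∀ s, 0 ≤ η s) →
    ∀ (t₁ t : ℝ), lo < t₁ → t₁ ≤ t → t < hi →
    ∀ (M GH T₁ TU Tb : ℝ → ℝ), (∀ s, M s = ∫ x, H (Φ s x) * Θ x ^ 2) →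
    (∀ s, GH s = ∫ x, deriv (deriv H) (Φ s x) * ‖gradient (Φ s) x‖ ^ 2 * Θ x ^ 2) →
    (∀ s, T₁ s = ∫ x, deriv H (Φ s x) * inner ℝ (gradient (Φ s) x) (gradient (fun y => Θ y ^ 2) x)) →
    (∀ s, TU s = ∫ x, H (Φ s x) * inner ℝ (U s x) (gradient (fun y => Θ y ^ 2) x)) →
    (∀ s, Tb s = ∫ x, 2 / cylRadius x * (H (Φ s x) * fderiv ℝ (fun y => Θ y ^ 2) x (eR x))) →
    η t * M t - η t₁ * M t₁ ≤ ∫ s in t₁..t, (η s * (-(GH s + T₁ s) + TU s + Tb s) + deriv η s * M s) := by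
  intro O hO lo hi Φ U hΦc hΦg hΦs hΦt hΦt' hUc hUs hdivU hU3 hsup k hk H hH hH' hHk Θ hΘ hΘc hΘO η hη hη0
    t₁ t h1 h1t ht M GH T₁ TU Tb hM hGH hT₁ hTU hTb
  -- ### the target in space–time form
  set μ : Measure (ℝ × EuclideanSpace ℝ (Fin 3)) := (volume.restrict (Ioc t₁ t)).prod volume with hμ
  set g₁ : ℝ × EuclideanSpace ℝ (Fin 3) → ℝ := fun z =>
    deriv (deriv H) (Φ z.1 z.2) * ‖gradient (Φ z.1) z.2‖ ^ 2 * Θ z.2 ^ 2 with hg₁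
  set g₂ : ℝ × EuclideanSpace ℝ (Fin 3) → ℝ := fun z =>
    deriv H (Φ z.1 z.2) * ⟪gradient (Φ z.1) z.2, gradient (fun y => Θ y ^ 2) z.2⟫ with hg₂
  set g₃ : ℝ × EuclideanSpace ℝ (Fin 3) → ℝ := fun z =>
    H (Φ z.1 z.2) * ⟪U z.1 z.2, gradient (fun y => Θ y ^ 2) z.2⟫ with hg₃
  set g₄ : ℝ × EuclideanSpace ℝ (Fin 3) → ℝ := fun z =>
    2 / cylRadius z.2 * (H (Φ z.1 z.2) * fderiv ℝ (fun y => Θ y ^ 2) z.2 (eR z.2)) with hg₄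
  set g₅ : ℝ × EuclideanSpace ℝ (Fin 3) → ℝ := fun z => H (Φ z.1 z.2) * Θ z.2 ^ 2 with hg₅
  set F : ℝ × EuclideanSpace ℝ (Fin 3) → ℝ := fun z =>
    η z.1 * (-(g₁ z + g₂ z) + g₃ z + g₄ z) + deriv η z.1 * g₅ z with hFdef
  obtain ⟨i₁, i₂, i₃, i₄, i₅⟩ := integrable_sliceIntegrands_acrossAxis hO hΦc hΦg hUc hU3 hH hΘ hΘc hΘO h1 ht
  have hFub := intervalIntegral_sliceFunctionals_eq_integral_prod hη h1t i₁ i₂ i₃ i₄ i₅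
  have iF : Integrable F μ := hFub.1
  -- the right-hand side of the claim is `∫ F dμ`
  have hRHS : ∫ s in t₁..t, (η s * (-(GH s + T₁ s) + TU s + Tb s) + deriv η s * M s) = ∫ z, F z ∂μ := by
    rw [← hFub.2]
    refine intervalIntegral.integral_congr fun s _ => ?_
    simp only [hGH, hT₁, hTU, hTb, hM]
  rw [hRHS, hM, hM]
  -- ### the axis cut-offs
  obtain ⟨CT, -, hCT⟩ := LeiZhang2011.exists_abs_deriv_smoothTransition_le
  set ε : ℕ → ℝ := fun n => 1 / ((n : ℝ) + 1) with hεdef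
  have hε0 : ∀ n, 0 < ε n := fun n => by rw [hεdef]; positivity
  have hεt : Tendsto ε atTop (𝓝 0) := tendsto_one_div_add_atTop_nhds_zero_nat
  set φ : ℕ → EuclideanSpace ℝ (Fin 3) → ℝ := fun n x => Real.smoothTransition (2 / ε n * cylRadius x - 1) with hφdef
  have hφP := fun n => axisCutoff_sq_props (hε0 n) hCT (φ := φ n) (fun x => rfl)
  -- the off-axis region and the cut products
  set O' : Set (EuclideanSpace ℝ (Fin 3)) := O ∩ {x | cylRadius x ≠ 0} with hO'def
  have hO' : IsOpen O' := hO.inter (isOpen_ne_fun continuous_cylRadius continuous_const)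
  have hO'ρ : ∀ x ∈ O', cylRadius x ≠ 0 := fun x hx => hx.2
  have hsubO : Ioo lo hi ×ˢ O' ⊆ Ioo lo hi ×ˢ O := prod_mono Subset.rfl inter_subset_left
  have hΘn : ∀ n, ContDiff ℝ 1 (fun y => Θ y * φ n y) := fun n => hΘ.mul (hφP n).1
  have hΘnc : ∀ n, HasCompactSupport (fun y => Θ y * φ n y) := fun n => hΘc.mul_right
  have hΘnO : ∀ n, tsupport (fun y => Θ y * φ n y) ⊆ O' := by
    intro n x hx
    have h := tsupport_cutoffProduct_subset (Θ := Θ) (hφP n).2.2.2.1 hx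
    refine ⟨hΘO h.1, fun h0 => ?_⟩
    have h2 : ε n / 2 ≤ cylRadius x := h.2
    rw [h0] at h2
    linarith [hε0 n]
  -- ### the off-axis inequality for `Θ_n`
  have hstep : ∀ n,
      η t * (∫ x, H (Φ t x) * (Θ x * φ n x) ^ 2) - η t₁ * (∫ x, H (Φ t₁ x) * (Θ x * φ n x) ^ 2) ≤
        ∫ z, (η z.1 * (-(deriv (deriv H) (Φ z.1 z.2) * ‖gradient (Φ z.1) z.2‖ ^ 2 * (Θ z.2 * φ n z.2) ^ 2 +
                deriv H (Φ z.1 z.2) * ⟪gradient (Φ z.1) z.2, gradient (fun y => (Θ y * φ n y) ^ 2) z.2⟫) +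
              H (Φ z.1 z.2) * ⟪U z.1 z.2, gradient (fun y => (Θ y * φ n y) ^ 2) z.2⟫ +
              2 / cylRadius z.2 * (H (Φ z.1 z.2) * fderiv ℝ (fun y => (Θ y * φ n y) ^ 2) z.2 (eR z.2))) +
            deriv η z.1 * (H (Φ z.1 z.2) * (Θ z.2 * φ n z.2) ^ 2)) ∂μ :=
    fun n => supersolution_energy_ineq_offAxis_prod O' hO' hO'ρ lo hi Φ U (hΦc.mono hsubO) hΦs (hΦg.mono hsubO)
      hΦt hΦt' hUc hUs hdivU hsup H hH hH' _ (hΘn n) (hΘnc n) (hΘnO n) η hη hη0 t₁ t h1 h1t ht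
  -- ### the integrand splits: `F_n = φ_n² F + ℓ_n`
  set ℓ : ℕ → ℝ × EuclideanSpace ℝ (Fin 3) → ℝ := fun n z => η z.1 * Θ z.2 ^ 2 *
      (-(deriv H (Φ z.1 z.2) * ⟪gradient (Φ z.1) z.2, gradient (fun y => φ n y ^ 2) z.2⟫) +
        H (Φ z.1 z.2) * ⟪U z.1 z.2, gradient (fun y => φ n y ^ 2) z.2⟫ +
        2 / cylRadius z.2 * (H (Φ z.1 z.2) * fderiv ℝ (fun y => φ n y ^ 2) z.2 (eR z.2))) with hℓdef
  have hsplit : ∀ n z,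
      η z.1 * (-(deriv (deriv H) (Φ z.1 z.2) * ‖gradient (Φ z.1) z.2‖ ^ 2 * (Θ z.2 * φ n z.2) ^ 2 +
              deriv H (Φ z.1 z.2) * ⟪gradient (Φ z.1) z.2, gradient (fun y => (Θ y * φ n y) ^ 2) z.2⟫) +
            H (Φ z.1 z.2) * ⟪U z.1 z.2, gradient (fun y => (Θ y * φ n y) ^ 2) z.2⟫ +
            2 / cylRadius z.2 * (H (Φ z.1 z.2) * fderiv ℝ (fun y => (Θ y * φ n y) ^ 2) z.2 (eR z.2))) +
          deriv η z.1 * (H (Φ z.1 z.2) * (Θ z.2 * φ n z.2) ^ 2) =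
        φ n z.2 ^ 2 * F z + ℓ n z := by
    intro n z
    rw [gradient_cutoffProduct_sq hΘ (hφP n).1, fderiv_cutoffProduct_sq_apply hΘ (hφP n).1, mul_pow,
      inner_add_right, inner_add_right, inner_smul_right, inner_smul_right, inner_smul_right, inner_smul_right]
    simp only [hFdef, hℓdef, hg₁, hg₂, hg₃, hg₄, hg₅]
    ring
  -- ### limits of the right-hand sides
  have hψm : ∀ n, AEStronglyMeasurable (fun z : ℝ × EuclideanSpace ℝ (Fin 3) => φ n z.2 ^ 2) μ := fun n =>
    ((hφP n).2.1.continuous.comp continuous_snd).aestronglyMeasurable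
  have hψ01 : ∀ n (z : ℝ × EuclideanSpace ℝ (Fin 3)), 0 ≤ φ n z.2 ^ 2 ∧ φ n z.2 ^ 2 ≤ 1 := fun n z => by
    obtain ⟨h0, h1'⟩ := (hφP n).2.2.1 z.2
    exact ⟨pow_nonneg h0 2, pow_le_one₀ h0 h1'⟩
  have hφ1 : ∀ x : EuclideanSpace ℝ (Fin 3), cylRadius x ≠ 0 → ∀ᶠ n in atTop, φ n x ^ 2 = 1 := by
    intro x hx
    have hρ : 0 < cylRadius x := lt_of_le_of_ne (cylRadius_nonneg x) (Ne.symm hx)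
    filter_upwards [hεt.eventually (Iic_mem_nhds hρ)] with n hn
    rw [(hφP n).2.2.2.2.1 x hn, one_pow]
  have hbulk : Tendsto (fun n => ∫ z, φ n z.2 ^ 2 * F z ∂μ) atTop (𝓝 (∫ z, F z ∂μ)) :=
    tendsto_integral_mul_of_eventually_eq_one iF hψm hψ01 (by
      filter_upwards [ae_prod_cylRadius_ne_zero t₁ t] with z hz using hφ1 z.2 hz)
  have hlayer : Tendsto (fun n => ∫ z, ℓ n z ∂μ) atTop (𝓝 0) :=
    tendsto_integral_axisLayer_zero h1 h1t ht hΦc hΦg hU3 hk hH hHk hΘ hΘc hΘO hη.continuous hε0 hεt hCT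
      (φ := φ) (fun _ _ => rfl)
  -- integrability of the pieces and the value of the right-hand side for `Θ_n`
  have iφF : ∀ n, Integrable (fun z => φ n z.2 ^ 2 * F z) μ := fun n =>
    iF.bdd_mul (hψm n) (ae_of_all _ fun z => by
      rw [Real.norm_of_nonneg (hψ01 n z).1]; exact (hψ01 n z).2)
  have iFn : ∀ n, Integrable (fun z =>
      η z.1 * (-(deriv (deriv H) (Φ z.1 z.2) * ‖gradient (Φ z.1) z.2‖ ^ 2 * (Θ z.2 * φ n z.2) ^ 2 +
              deriv H (Φ z.1 z.2) * ⟪gradient (Φ z.1) z.2, gradient (fun y => (Θ y * φ n y) ^ 2) z.2⟫) +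
            H (Φ z.1 z.2) * ⟪U z.1 z.2, gradient (fun y => (Θ y * φ n y) ^ 2) z.2⟫ +
            2 / cylRadius z.2 * (H (Φ z.1 z.2) * fderiv ℝ (fun y => (Θ y * φ n y) ^ 2) z.2 (eR z.2))) +
          deriv η z.1 * (H (Φ z.1 z.2) * (Θ z.2 * φ n z.2) ^ 2)) μ := by
    intro n
    obtain ⟨j₁, j₂, j₃, j₄, j₅⟩ := integrable_sliceIntegrands_offAxis hO'ρ (hΦc.mono hsubO) (hΦg.mono hsubO) hUc hH
      (hΘn n) (hΘnc n) (hΘnO n) h1 ht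
    exact (intervalIntegral_sliceFunctionals_eq_integral_prod hη h1t j₁ j₂ j₃ j₄ j₅).1
  have iℓ : ∀ n, Integrable (ℓ n) μ := fun n =>
    ((iFn n).sub (iφF n)).congr (ae_of_all _ fun z => by
      simp only [Pi.sub_apply, hsplit]
      ring)
  have hRHSn : ∀ n, ∫ z, (η z.1 * (-(deriv (deriv H) (Φ z.1 z.2) * ‖gradient (Φ z.1) z.2‖ ^ 2 * (Θ z.2 * φ n z.2) ^ 2 +
              deriv H (Φ z.1 z.2) * ⟪gradient (Φ z.1) z.2, gradient (fun y => (Θ y * φ n y) ^ 2) z.2⟫) +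
            H (Φ z.1 z.2) * ⟪U z.1 z.2, gradient (fun y => (Θ y * φ n y) ^ 2) z.2⟫ +
            2 / cylRadius z.2 * (H (Φ z.1 z.2) * fderiv ℝ (fun y => (Θ y * φ n y) ^ 2) z.2 (eR z.2))) +
          deriv η z.1 * (H (Φ z.1 z.2) * (Θ z.2 * φ n z.2) ^ 2)) ∂μ =
      (∫ z, φ n z.2 ^ 2 * F z ∂μ) + ∫ z, ℓ n z ∂μ := by
    intro n
    rw [← integral_add (iφF n) (iℓ n)]
    exact integral_congr_ae (ae_of_all _ fun z => hsplit n z)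
  -- ### limits of the left-hand sides: `M_n(s) → M(s)`
  have hslice : ∀ s ∈ Icc t₁ t, Tendsto (fun n => ∫ x, H (Φ s x) * (Θ x * φ n x) ^ 2) atTop
      (𝓝 (∫ x, H (Φ s x) * Θ x ^ 2)) := by
    intro s hs
    have hsI : s ∈ Ioo lo hi := ⟨h1.trans_le hs.1, hs.2.trans_lt ht⟩
    have hΦs_cont : ContinuousOn (fun x => H (Φ s x)) O := by
      have h := hΦc.comp (Continuous.prodMk_right s).continuousOn (fun x hx => mk_mem_prod hsI hx)
      exact hH.continuous.comp_continuousOn h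
    have hcont : Continuous fun x => H (Φ s x) * Θ x ^ 2 :=
      continuous_mul_of_continuousOn_of_eq_zero_off hO hΘc hΘO hΦs_cont (hΘ.continuous.pow 2)
        (fun x hx => by rw [image_eq_zero_of_notMem_tsupport hx]; ring)
    have hint : Integrable (fun x => H (Φ s x) * Θ x ^ 2) :=
      hcont.integrable_of_hasCompactSupport
        (HasCompactSupport.intro hΘc fun x hx => by rw [image_eq_zero_of_notMem_tsupport hx]; ring)
    have e : ∀ n, (fun x => H (Φ s x) * (Θ x * φ n x) ^ 2) = fun x => φ n x ^ 2 * (H (Φ s x) * Θ x ^ 2) := by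
      intro n; funext x; ring
    simp_rw [e]
    refine tendsto_integral_mul_of_eventually_eq_one hint
      (fun n => ((hφP n).2.1.continuous).aestronglyMeasurable) (fun n x => ?_) ?_
    · obtain ⟨h0, h1'⟩ := (hφP n).2.2.1 x
      exact ⟨pow_nonneg h0 2, pow_le_one₀ h0 h1'⟩
    · have h0 : (volume : Measure (EuclideanSpace ℝ (Fin 3))) {x | cylRadius x = 0} = 0 :=
        volume_setOf_cylRadius_eq_zero
      filter_upwards [measure_eq_zero_iff_ae_notMem.1 h0] with x hx using hφ1 x hx
  have hLHS : Tendsto (fun n => η t * (∫ x, H (Φ t x) * (Θ x * φ n x) ^ 2) -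
      η t₁ * (∫ x, H (Φ t₁ x) * (Θ x * φ n x) ^ 2)) atTop
      (𝓝 (η t * (∫ x, H (Φ t x) * Θ x ^ 2) - η t₁ * (∫ x, H (Φ t₁ x) * Θ x ^ 2))) :=
    ((hslice t ⟨h1t, le_rfl⟩).const_mul _).sub ((hslice t₁ ⟨le_rfl, h1t⟩).const_mul _)
  have hRHSlim : Tendsto (fun n => (∫ z, φ n z.2 ^ 2 * F z ∂μ) + ∫ z, ℓ n z ∂μ) atTop (𝓝 (∫ z, F z ∂μ)) := by
    have h := hbulk.add hlayer
    rwa [add_zero] at h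
  -- ### conclusion
  refine le_of_tendsto_of_tendsto' hLHS hRHSlim fun n => ?_
  rw [← hRHSn n]
  exact hstep n

end Summit.NavierStokesRegularity.NavierStokesRegularity.Theorems.AxisymmetricKatoGlobal.EulerScaling

end
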